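import Mathlib
import Literature.Barriers.Schanuel.LargeTranscendenceDegree
import Literature.NumberTheory.Transcendental.LindemannWeierstrassProofs
import Literature.NumberTheory.Transcendental.SchanuelEclEmptyProofs
import Summits.Schanuel.Schanuel.Theorems.RootDecomp1EAnchorToolkit

/-!
# RootDecomp1E — ROUND 7 rung «MultiplicationType» (lens 2, gen 7): the E-STABLE cell of length ≤ 3 is DECIDED

Port, for the census / prover seat, of the decided layer of `HOME/decomp-schanuel-lens-2/g7/MultiplicationType.lean`:
the round-7 child `EStableDefectOne` of `route-Schanuel-RootDecomp1E` («Schanuel defect ≤ 1 for ℚ-spans with an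
irrational algebraic multiplier, first-failure-local») HOLDS in every length `n ≤ 3`:
* `n ≤ 2`: every ℚ-independent tuple has defect ≤ 1 (Hermite–Lindemann, `transcendental_exp_holds`);
* `n = 3`: an irrational algebraic multiplier `β` of a 3-dimensional ℚ-space is CUBIC — no quadratic field acts on an
  odd-dimensional ℚ-space (`eLine_linearIndependent`: two distinct `β`-stable planes meet trivially, `2 + 2 > 3`) — so
  `span_ℚ z = λ(ℚ + ℚβ + ℚβ²)`, and Waldschmidt's Theorem 2.9 (`t₂`-clause, `d = 2`, `ℓ = 3`, `x = (1, β)`,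
  `y = (λ, βλ, β²λ)`, `3 + 2 < 6`; Gel'fond 1949 / Tijdeman / Brownawell–Waldschmidt — NO technical hypothesis), here the
  hypothesis `h29 : Literature.Barriers.Schanuel.smallTrdeg_thm_2_9_pos` (PROVED in tree:
  `Literature.Barriers.Schanuel.smallTrdeg_thm_2_9_pos_holds`), gives `trdeg ℚ(z, e^z) ≥ 2 = n − 1` after transporting
  all grid generators into `ℚ(z, e^z)` (each `β^k λ`, `k ≤ 3`, lies in the span).
Schanuel itself is OPEN on this cell (`trdeg = 3`: `e, e^β, e^{β²}`; `log α, α^β, α^{β²}` — Gel'fond's problem), so the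
rung lies outside S's known regime.  Statement = the item's binders verbatim with `n ≤ 3` inserted (last theorem).

PORT INSTRUCTIONS. Target `Summits/Schanuel/Schanuel/Theorems/RootDecomp1EEStableRung.lean`; `ledger propose --kind proof
… --supports <EStableDefectOne item>` (restricted layer, not a close).  No `instance`, no notation, nothing restated from
the route file (the item text is inlined as binders; the route file is imported only through the tree toolkit
`Theorems.RootDecomp1EAnchorToolkit`, whose four bookkeeping lemmas are cited, so this file compiles before and after the writer's edit).  If `Literature.Barriers.Schanuel.LargeTranscendenceDegreeThm29Holds` builds on the farm, add
`theorem eStableDefectOne_le_three_holds := eStableDefectOne_le_three Literature.Barriers.Schanuel.smallTrdeg_thm_2_9_pos_holds`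
with that import (it answered rc 75 `stale … unbuilt ExpSmallTrdegProofsIV` on 2026-08-30 08:05Z).
-/

set_option linter.dupNamespace false

noncomputable section

namespace Summit.Schanuel.Schanuel.Theorems.RootDecomp1EEStableRung

open Complex IntermediateField Module
open Literature.NumberTheory.Transcendental (exists_nsmul_mem_span_int mem_adjoin_of_mem_span_int
  trdeg_adjoin_le_of_le isAlgebraic_adjoin_over_algebraAdjoin transcendental_exp_holds)
open Literature.Barriers.Schanuel (gridField₂ smallTrdeg_thm_2_9_pos)
-- tree toolkit of the 1E cone (landed p766231): cited, not restated
open Summit.Schanuel.Schanuel.Theorems.RootDecomp1EAnchor (isAlgebraic_of_mem_adjoin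
  trdeg_adjoin_le_of_isAlgebraic mem_adjoin_of_mem_span exp_isAlgebraic_of_mem_span)

/-! ## Toolkit (two small lemmas not in the tree toolkit `Theorems.RootDecomp1EAnchorToolkit`) -/

/-- A transcendental generator forces `trdeg ≥ 1`. -/
theorem one_le_trdeg_adjoin_of_transcendental {S : Set ℂ} {x : ℂ} (hx : Transcendental ℚ x)
    (hxS : x ∈ S) : (1 : Cardinal) ≤ Algebra.trdeg ℚ ↥(adjoin ℚ S) := by
  have h1 : (1 : Cardinal) ≤ Algebra.trdeg ℚ ↥(adjoin ℚ ({x} : Set ℂ)) := by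
    haveI : Algebra.Transcendental ℚ ↥(adjoin ℚ ({x} : Set ℂ)) :=
      ⟨⟨⟨x, mem_adjoin_simple_self ℚ x⟩, fun h => hx (IntermediateField.isAlgebraic_iff.mp h)⟩⟩
    exact Cardinal.one_le_iff_pos.mpr (trdeg_pos ℚ ↥(adjoin ℚ ({x} : Set ℂ)))
  exact h1.trans (Literature.Barriers.Schanuel.trdeg_mono (adjoin.mono ℚ _ _ (Set.singleton_subset_iff.mpr hxS)))

/-- In a `β`-stable span, `β` multiplies the whole span into itself. -/
theorem mul_mem_span_of_gens {n : ℕ} {z : Fin n → ℂ} {β : ℂ}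
    (h : ∀ i, β * z i ∈ Submodule.span ℚ (Set.range z)) {v : ℂ}
    (hv : v ∈ Submodule.span ℚ (Set.range z)) : β * v ∈ Submodule.span ℚ (Set.range z) := by
  induction hv using Submodule.span_induction with
  | mem x hx =>
    obtain ⟨i, rfl⟩ := hx
    exact h i
  | zero => simp
  | add x y _ _ hx hy =>
    rw [mul_add]
    exact add_mem hx hy
  | smul q x _ hx =>
    rw [mul_smul_comm]
    exact Submodule.smul_mem _ q hx


/-! ## DECIDED LAYER, part 1: `S⁻` holds in every length `n ≤ 2` (Hermite–Lindemann) -/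

/-- `S⁻` (defect `≤ 1`) holds for EVERY ℚ-independent tuple of length `≤ 2`: for `n = 2` one needs a
single transcendental among `z₀, e^{z₀}`, which is Hermite–Lindemann (`transcendental_exp_holds`). -/
theorem defectOne_of_le_two (n : ℕ) (hn : n ≤ 2) (z : Fin n → ℂ) (hz : LinearIndependent ℚ z) :
    (n : Cardinal) ≤ Algebra.trdeg ℚ ↥(adjoin ℚ (Set.range z ∪ Set.range (cexp ∘ z))) + 1 := by
  rcases n with _ | _ | _ | n
  · simp
  · simp
  · have h0 : z 0 ≠ 0 := hz.ne_zero 0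
    have h1 : (1 : Cardinal) ≤ Algebra.trdeg ℚ ↥(adjoin ℚ (Set.range z ∪ Set.range (cexp ∘ z))) := by
      by_cases halg : IsAlgebraic ℚ (z 0)
      · exact one_le_trdeg_adjoin_of_transcendental (transcendental_exp_holds halg h0)
          (Or.inr ⟨0, rfl⟩)
      · exact one_le_trdeg_adjoin_of_transcendental halg (Or.inl ⟨0, rfl⟩)
    have h2 : (1 : Cardinal) + 1 ≤
        Algebra.trdeg ℚ ↥(adjoin ℚ (Set.range z ∪ Set.range (cexp ∘ z))) + 1 :=
      add_le_add h1 le_rfl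
    rw [one_add_one_eq_two] at h2
    exact_mod_cast h2
  · omega

/-! ## DECIDED LAYER, part 2: an irrational algebraic multiplier on a 3-dimensional span is CUBIC
(no quadratic field acts on an odd-dimensional ℚ-space), so the span is the E-line `λ·(1, β, β²)` -/

section ELine

variable {β : ℂ}

/-- The `E`-line germ through `u`: `span_ℚ(u, βu)`. -/
def plane (β u : ℂ) : Submodule ℚ ℂ := Submodule.span ℚ (Set.range ![u, β * u])

/-- `u` lies in the plane `span{u, βu}`. -/
theorem mem_plane_self (β u : ℂ) : u ∈ plane β u :=
  Submodule.subset_span ⟨0, by simp⟩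

/-- `βu` lies in the plane `span{u, βu}`. -/
theorem mul_mem_plane_self (β u : ℂ) : β * u ∈ plane β u :=
  Submodule.subset_span ⟨1, by simp⟩

/-- The plane `span{u, βu}` is finite-dimensional. -/
theorem plane_finiteDimensional (β u : ℂ) : FiniteDimensional ℚ ↥(plane β u) :=
  FiniteDimensional.span_of_finite ℚ (Set.finite_range _)

/-- If `β² = p + q β` (`p q ∈ ℚ`), the plane is `β`-stable. -/
theorem mul_mem_plane {p q : ℚ} (hβ : β ^ 2 = algebraMap ℚ ℂ p + algebraMap ℚ ℂ q * β) (u : ℂ)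
    {v : ℂ} (hv : v ∈ plane β u) : β * v ∈ plane β u := by
  induction hv using Submodule.span_induction with
  | mem x hx =>
    obtain ⟨i, rfl⟩ := hx
    fin_cases i
    · simpa using mul_mem_plane_self β u
    · have h : β * (β * u) = p • u + q • (β * u) := by
        rw [← mul_assoc, ← pow_two, hβ, Algebra.smul_def, Algebra.smul_def]
        ring
      simpa [h] using add_mem (Submodule.smul_mem _ p (mem_plane_self β u))
        (Submodule.smul_mem _ q (mul_mem_plane_self β u))
  | zero => simp
  | add x y _ _ hx hy =>
    rw [mul_add]
    exact add_mem hx hy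
  | smul r x _ hx =>
    rw [mul_smul_comm]
    exact Submodule.smul_mem _ r hx

/-- `u ≠ 0` and `β ∉ ℚ` make `(u, βu)` independent. -/
theorem pair_linearIndependent (hβq : β ∉ Set.range (algebraMap ℚ ℂ)) {u : ℂ} (hu : u ≠ 0) :
    LinearIndependent ℚ ![u, β * u] := by
  rw [LinearIndependent.pair_iff]
  intro s t hst
  rw [Algebra.smul_def, Algebra.smul_def] at hst
  have h : (algebraMap ℚ ℂ s + algebraMap ℚ ℂ t * β) * u = 0 := by
    rw [← hst]; ring
  have h' : algebraMap ℚ ℂ s + algebraMap ℚ ℂ t * β = 0 := by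
    rcases mul_eq_zero.mp h with h | h
    · exact h
    · exact absurd h hu
  by_cases ht : t = 0
  · subst ht
    have hs : algebraMap ℚ ℂ s = 0 := by simpa using h'
    exact ⟨(map_eq_zero_iff _ (algebraMap ℚ ℂ).injective).mp hs, rfl⟩
  · exfalso
    apply hβq
    refine ⟨-s / t, ?_⟩
    have htC : algebraMap ℚ ℂ t ≠ 0 := (map_ne_zero_iff _ (algebraMap ℚ ℂ).injective).mpr ht
    rw [map_div₀, map_neg, div_eq_iff htC]
    linear_combination -h'

/-- The plane `span{u, βu}` has dimension 2 (β irrational, u ≠ 0). -/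
theorem finrank_plane (hβq : β ∉ Set.range (algebraMap ℚ ℂ)) {u : ℂ} (hu : u ≠ 0) :
    finrank ℚ ↥(plane β u) = 2 := by
  rw [plane, finrank_span_eq_card (pair_linearIndependent hβq hu)]
  simp

/-- Two `β`-stable planes through a common nonzero vector coincide. -/
theorem plane_eq_of_mem {p q : ℚ} (hβ : β ^ 2 = algebraMap ℚ ℂ p + algebraMap ℚ ℂ q * β)
    (hβq : β ∉ Set.range (algebraMap ℚ ℂ)) {u v : ℂ} (hu : u ≠ 0) (hv : v ∈ plane β u)
    (hv0 : v ≠ 0) : plane β v = plane β u := by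
  haveI := plane_finiteDimensional β u
  have hle : plane β v ≤ plane β u := by
    rw [plane, Submodule.span_le]
    rintro _ ⟨i, rfl⟩
    fin_cases i
    · simpa using hv
    · simpa using mul_mem_plane hβ u hv
  exact Submodule.eq_of_le_of_finrank_eq hle (by rw [finrank_plane hβq hv0, finrank_plane hβq hu])

/-- **No quadratic multiplier in dimension 3.** If `z : Fin 3 → ℂ` is ℚ-independent, `β ∉ ℚ` and
`β • span z ⊆ span z`, then `(z₀, β z₀, β² z₀)` is ℚ-independent (so `β` is cubic and
`span_ℚ z = z₀ · (ℚ + ℚβ + ℚβ²)`). -/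
theorem eLine_linearIndependent {z : Fin 3 → ℂ} (hz : LinearIndependent ℚ z)
    (hβq : β ∉ Set.range (algebraMap ℚ ℂ))
    (hst : ∀ i, β * z i ∈ Submodule.span ℚ (Set.range z)) :
    LinearIndependent ℚ ![z 0, β * z 0, β ^ 2 * z 0] := by
  classical
  by_contra hdep
  obtain ⟨g, hsum, i₀, hi₀⟩ := Fintype.not_linearIndependent_iff.mp hdep
  have h0 : z 0 ≠ 0 := hz.ne_zero 0
  simp only [Fin.sum_univ_three, Matrix.cons_val_zero, Matrix.cons_val_one, Matrix.head_cons,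
    Matrix.cons_val_two, Matrix.tail_cons, Algebra.smul_def] at hsum
  have key : (algebraMap ℚ ℂ (g 0) + algebraMap ℚ ℂ (g 1) * β + algebraMap ℚ ℂ (g 2) * β ^ 2)
      * z 0 = 0 := by
    rw [← hsum]; ring
  have key' : algebraMap ℚ ℂ (g 0) + algebraMap ℚ ℂ (g 1) * β + algebraMap ℚ ℂ (g 2) * β ^ 2 = 0 := by
    rcases mul_eq_zero.mp key with h | h
    · exact h
    · exact absurd h h0
  by_cases hg2 : g 2 = 0
  · -- then `g 0 + g 1 β = 0`: either `β ∈ ℚ` or all coefficients vanish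
    rw [hg2, map_zero, zero_mul, add_zero] at key'
    by_cases hg1 : g 1 = 0
    · rw [hg1, map_zero, zero_mul, add_zero] at key'
      have hg0 : g 0 = 0 := (map_eq_zero_iff _ (algebraMap ℚ ℂ).injective).mp key'
      apply hi₀
      fin_cases i₀ <;> assumption
    · apply hβq
      refine ⟨-g 0 / g 1, ?_⟩
      have h1C : algebraMap ℚ ℂ (g 1) ≠ 0 :=
        (map_ne_zero_iff _ (algebraMap ℚ ℂ).injective).mpr hg1
      rw [map_div₀, map_neg, div_eq_iff h1C]
      linear_combination -key'
  · -- `β` is quadratic: `β² = p + q β`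
    have h2C : algebraMap ℚ ℂ (g 2) ≠ 0 := (map_ne_zero_iff _ (algebraMap ℚ ℂ).injective).mpr hg2
    have hβ : β ^ 2 = algebraMap ℚ ℂ (-g 0 / g 2) + algebraMap ℚ ℂ (-g 1 / g 2) * β := by
      rw [map_div₀, map_neg, map_div₀, map_neg]
      field_simp
      linear_combination key'
    -- the ambient span and the plane through `z 0`
    set V : Submodule ℚ ℂ := Submodule.span ℚ (Set.range z) with hV
    haveI : FiniteDimensional ℚ ↥V := FiniteDimensional.span_of_finite ℚ (Set.finite_range z)
    have hVrank : finrank ℚ ↥V = 3 := by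
      rw [hV, finrank_span_eq_card hz]; simp
    have hplane_le : ∀ u ∈ V, plane β u ≤ V := by
      intro u hu
      rw [plane, Submodule.span_le]
      rintro _ ⟨i, rfl⟩
      fin_cases i
      · simpa using hu
      · simpa using mul_mem_span_of_gens hst hu
    have hz0V : z 0 ∈ V := Submodule.subset_span ⟨0, rfl⟩
    haveI := plane_finiteDimensional β (z 0)
    -- some `z i` escapes the plane through `z 0`
    have hex : ∃ i, z i ∉ plane β (z 0) := by
      by_contra hall
      have hall' : ∀ i, z i ∈ plane β (z 0) := fun i => not_not.mp (not_exists.mp hall i)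
      have hle : V ≤ plane β (z 0) := by
        rw [hV, Submodule.span_le]
        rintro _ ⟨i, rfl⟩
        exact hall' i
      have := Submodule.finrank_mono hle
      rw [hVrank, finrank_plane hβq h0] at this
      omega
    obtain ⟨i, hi⟩ := hex
    haveI := plane_finiteDimensional β (z i)
    have hzi0 : z i ≠ 0 := hz.ne_zero i
    have hziV : z i ∈ V := Submodule.subset_span ⟨i, rfl⟩
    -- the two planes meet trivially
    have hinf : plane β (z 0) ⊓ plane β (z i) = ⊥ := by
      rw [Submodule.eq_bot_iff]
      intro x hx
      by_contra hx0
      have h1 : plane β x = plane β (z 0) := plane_eq_of_mem hβ hβq h0 hx.1 hx0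
      have h2 : plane β x = plane β (z i) := plane_eq_of_mem hβ hβq hzi0 hx.2 hx0
      apply hi
      rw [← h1, h2]
      exact mem_plane_self β (z i)
    -- dimension count: 2 + 2 ≤ 3
    have hdim := Submodule.finrank_sup_add_finrank_inf_eq (plane β (z 0)) (plane β (z i))
    rw [hinf, finrank_bot, add_zero, finrank_plane hβq h0, finrank_plane hβq hzi0] at hdim
    have hsup_le : plane β (z 0) ⊔ plane β (z i) ≤ V :=
      sup_le (hplane_le _ hz0V) (hplane_le _ hziV)
    have := Submodule.finrank_mono hsup_le
    rw [hdim, hVrank] at this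
    omega

end ELine

/-! ## DECIDED LAYER, part 3: the E-stable cell of length 3 via Waldschmidt's Theorem 2.9 (`t₂`-clause,
`d = 2`, `ℓ = 3`: Gelfond 1949 / Brownawell–Waldschmidt), a THEOREM in tree (`smallTrdeg_thm_2_9_pos_holds`) -/

/-- `(1, β)` is ℚ-independent for `β ∉ ℚ`. -/
theorem one_beta_linearIndependent {β : ℂ} (hβq : β ∉ Set.range (algebraMap ℚ ℂ)) :
    LinearIndependent ℚ ![(1 : ℂ), β] := by
  simpa using pair_linearIndependent hβq one_ne_zero

/-- **THE DECIDED CELL.** `S⁻` holds — with room to spare, `trdeg ≥ 2 = n − 1` — for every E-STABLE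
ℚ-independent triple: the span is `λ(1, β, β²)` with `β` cubic, and Theorem 2.9 (`t₂`-clause) applied to
`x = (1, β)`, `y = (λ, βλ, β²λ)` (`3 + 2 < 2·3`) gives `trdeg ℚ(x, y, e^{x_i y_j}) ≥ 2`; all these generators
are algebraic over `F_z = ℚ(z, e^z)` because `β^k λ ∈ span_ℚ z` for `k ≤ 3`. -/
theorem two_le_trdeg_of_eStable_three (h29 : smallTrdeg_thm_2_9_pos) (z : Fin 3 → ℂ)
    (hz : LinearIndependent ℚ z)
    (hE : ∃ β : ℂ, IsAlgebraic ℚ β ∧ β ∉ Set.range (algebraMap ℚ ℂ) ∧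
      ∀ i, β * z i ∈ Submodule.span ℚ (Set.range z)) :
    (2 : Cardinal) ≤ Algebra.trdeg ℚ ↥(adjoin ℚ (Set.range z ∪ Set.range (cexp ∘ z))) := by
  obtain ⟨β, hβalg, hβq, hst⟩ := hE
  set x : Fin 2 → ℂ := ![(1 : ℂ), β] with hx
  set y : Fin 3 → ℂ := ![z 0, β * z 0, β ^ 2 * z 0] with hy
  have hxli : LinearIndependent ℚ x := one_beta_linearIndependent hβq
  have hyli : LinearIndependent ℚ y := eLine_linearIndependent hz hβq hst
  have h2 := ((h29 2 3 x y (by norm_num) (by norm_num) hxli hyli).2.2 (by norm_num))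
  refine h2.trans ?_
  set F : IntermediateField ℚ ℂ := adjoin ℚ (Set.range z ∪ Set.range (cexp ∘ z)) with hF
  have hV : ∀ v ∈ Submodule.span ℚ (Set.range z), β * v ∈ Submodule.span ℚ (Set.range z) :=
    fun v hv => mul_mem_span_of_gens hst hv
  have hz0 : z 0 ∈ Submodule.span ℚ (Set.range z) := Submodule.subset_span ⟨0, rfl⟩
  have hyV : ∀ j, y j ∈ Submodule.span ℚ (Set.range z) := by
    intro j
    fin_cases j
    · simpa [hy] using hz0
    · simpa [hy] using hV _ hz0
    · have : β ^ 2 * z 0 = β * (β * z 0) := by ring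
      simpa [hy, this] using hV _ (hV _ hz0)
  have hxV : ∀ i, ∀ v ∈ Submodule.span ℚ (Set.range z), x i * v ∈ Submodule.span ℚ (Set.range z) := by
    intro i v hv
    fin_cases i
    · simpa [hx] using hv
    · simpa [hx] using hV v hv
  show Algebra.trdeg ℚ ↥(adjoin ℚ (Set.range x ∪ Set.range y ∪
      Set.range (fun p : Fin 2 × Fin 3 => cexp (x p.1 * y p.2)))) ≤ Algebra.trdeg ℚ ↥F
  apply trdeg_adjoin_le_of_isAlgebraic
  rintro t ((⟨i, rfl⟩ | ⟨j, rfl⟩) | ⟨p, rfl⟩)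
  · fin_cases i
    · simpa [hx] using (isAlgebraic_one : IsAlgebraic ℚ (1 : ℂ)).tower_top (L := ↥F)
    · simpa [hx] using hβalg.tower_top (L := ↥F)
  · exact isAlgebraic_of_mem_adjoin (mem_adjoin_of_mem_span (hyV j))
  · exact exp_isAlgebraic_of_mem_span (hxV p.1 _ (hyV p.2))

/-- **RUNG = the item `EStableDefectOne` RESTRICTED TO `n ≤ 3`** (binders of the item verbatim, the restriction
`n ≤ 3` inserted after `n`, the sub-minimality hypothesis kept and unused), given Theorem 2.9 as the hypothesis `h29`
(a tree THEOREM: discharge with `Literature.Barriers.Schanuel.smallTrdeg_thm_2_9_pos_holds` of module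
`Literature.Barriers.Schanuel.LargeTranscendenceDegreeThm29Holds` once the farm has built its cone — see
`eStableDefectOne_le_three_holds` in the addendum if present). -/
theorem eStableDefectOne_le_three (h29 : smallTrdeg_thm_2_9_pos) :
    ∀ (n : ℕ), n ≤ 3 → ∀ (z : Fin n → ℂ), LinearIndependent ℚ z →
      (∃ β : ℂ, IsAlgebraic ℚ β ∧ β ∉ Set.range (algebraMap ℚ ℂ) ∧
        ∀ i, β * z i ∈ Submodule.span ℚ (Set.range z)) →
      (∀ (m : ℕ) (w : Fin m → ℂ), m < n → LinearIndependent ℚ w →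
        (∀ j, w j ∈ Submodule.span ℚ (Set.range z)) →
        (m : Cardinal) ≤ Algebra.trdeg ℚ ↥(IntermediateField.adjoin ℚ
          (Set.range w ∪ Set.range (Complex.exp ∘ w))) + 1) →
      (n : Cardinal) ≤ Algebra.trdeg ℚ ↥(IntermediateField.adjoin ℚ
        (Set.range z ∪ Set.range (Complex.exp ∘ z))) + 1 := by
  intro n hn z hz hE _hsub
  rcases Nat.lt_or_ge n 3 with h | h
  · exact defectOne_of_le_two n (by omega) z hz
  · obtain rfl : n = 3 := le_antisymm hn h
    have h2 := two_le_trdeg_of_eStable_three h29 z hz hE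
    have h3 : (2 : Cardinal) + 1 ≤
        Algebra.trdeg ℚ ↥(adjoin ℚ (Set.range z ∪ Set.range (cexp ∘ z))) + 1 :=
      add_le_add h2 le_rfl
    have h21 : (2 : Cardinal) + 1 = 3 := by norm_num
    rw [h21] at h3
    exact_mod_cast h3


end Summit.Schanuel.Schanuel.Theorems.RootDecomp1EEStableRung

end
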